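import Summits.HodgeConjecture.HodgeConjecture.Theorems.F0P3cStCharTSUpTrTubeAnyCartan       -- ★ (N4-b) p852467 (LH10-p01): `setIntegral_mul_classFun_cartanSet_eq` (the class-function tube formula at ANY Cartan, socket paid)
import Summits.HodgeConjecture.HodgeConjecture.Theorems.F0P3cStCharTSWeylCartanWIF          -- ★ (E2b)-WIF (F0P3a-p05): §1 `integral_eq_sum_setIntegral_cartanSet` (the `ι`-indexed Cartan partition of `∫_G`)
import Summits.HodgeConjecture.HodgeConjecture.Theorems.F0P3cStCharTSSingularNull           -- ★ (J8) (LH5-p03): `measure_setOf_not_isRegularElt_Gqs_eq_zero_of_forall`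
import Summits.HodgeConjecture.HodgeConjecture.Theorems.F0P3cStCharTSUpTrAssemblyCore       -- ★ (A1′)-E p852534 (LH10-p01): the letters `dG hdG hdGsq dH SH tH cW hSW` and the (UP-DEF) inline spelling; brings ★ `finKappaAt_conj_right`
import Summits.HodgeConjecture.HodgeConjecture.Theorems.F0P3cStCharTSUpTrClaimP             -- ★ (P3) p852453 (LH3-p04): `isLocalNormPair_of_isConj_right`
import HarnessLib

/-!
# F0 · P3c · ROAD «UP-TR» (A1″) «UP-TR-FULL», FILE U3-core «ASSEMBLY WITHOUT LOCAL BOUNDEDNESS, FROM NAMED INPUTS»: `∫_G f · α^G dνQv = ∫_H f^H · α dνHv` from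
# (N4-b) at every member of CARTAN-ALL, the elliptic part (U1), the split part (U2) and stable Weyl integration on `H_v` (Rogawski 1990 §12.5 pp. 182–185, Lemma 12.5.1)

Cell `pub/hodgecm-mathlib`, crux H413 = `stmt-HodgeConjecture-24833` (lane `--supports … --as helper`, count-neutral); seat F0P2-p01 (g25) ((A1″) pen (U1)+(U3), LEAD F0P3a-plan (g16)
T15-04 «GO-LOW»; (U2) pen F0P3-p02 (g25)).  THEOREMS ONLY (no definition ∕ instance ∕ notation ∕ named fact ∕ `sorry`); ★-only imports; axioms TRIO.

WHAT.  The twin of ★ (A1′)-E `F0P3cStCharTSUpTrAssemblyCore.upTransferLB_concrete_of_inputs` WITHOUT the slot-wise integrability inputs `hIntG`∕`hIntT` (which ★ F could only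
discharge from the local boundedness of `D_H · α`): here the `G`-side is NEVER split below the torus.  With ABSTRACT closed forms `dG` (a class function, `dG² = D` on the regular
set — `hdG`, `hdGsq`) and `dH`, the system of representatives `C ∋ M` of the Cartan classes of `G = U(Φ₃)(L⁺_v)` in the letters of ★ INSTANTIATE-CARTAN (`hZC`, `hcovC`, `hncC`, THE
core-one Haar measures `μTf`), and `α^G` spelled by (UP-DEF) inline:
(1) ★ (E2b)-WIF §1 `integral_eq_sum_setIntegral_cartanSet` (singular set null, ★ (J8)): `∫_G f α^G = Σ_{T′ ∈ C} ∫_{G_{T′}} f α^G` — only the integrability of the GIVEN total `f · α^G`;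
(2) ★ (N4-b) `setIntegral_mul_classFun_cartanSet_eq` at each `T′ ∈ C` (`α^G` a class function on the regular set — ★ `finKappaAt_conj_right`, ★ `isLocalNormPair_of_isConj_right`, `hdG`):
`∫_{G_{T′}} f α^G = [N(T′):T′]⁻¹ • ∫_{T′^{reg}} D • (α^G · Φ_G(⟦·⟧, f)) dμTf T′`, rewritten `= ([N(T′):T′])⁻¹ · ∫_{T′} dG² · α^G · Φ_G(⟦·⟧, f) dμTf T′` (§1; `α^G` vanishes off the regular set);
(3) the split member `M` is the letter `hM` (= (U2) `…UpTrSplitSlot`'s head, WANTS-U2 v1 f46ea0ce4728cb96) and the elliptic members `Sell = C ∖ {M}` are the letter `hEll` (= (U1)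
`…UpTrSlotTransport.ellipticTorusSum_upIntegrand_eq_of_inputs`' head): both land on `Σ_T cW T · ∫_T dH² · α · Φ^st_H(·, f^H) dtH T` over the `H`-Cartan system `SH = insert M_H SHc`;
(4) the `G`-singular part of every `H`-Cartan is `tH`-null (`hsingH`), so these are the set integrals over `T^{G-reg}` of ★ (H6b′)∕(F7b) SWIFH's conclusion `hSW`, which closes.
* §1 `invIndex_smul_setIntegral_weight_eq` — the currency bridge (2) (real `•`, set integral over `T′^{reg}`, weight `D = √(∏|disc|·(∏|det|)⁻²)`) ↦ (complex `·`, full integral, `dG²`).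
* §2 `upTransfer_of_inputs` — the assembly.
HONEST LABEL: count-neutral; closes no organ; the UP-TR consequent left the organ at ED. 26 on the LB reading and the card caveat «general-`α` clause 3 NOT claimed» is struck only when
the concrete head (U3) `…UpTrAssemblyFull :: upTransfer_concrete` is ★; HC_CM is proved only modulo the printed citations (hLiu418 24832 ∕ h413 24833) until rung 0 closes.

## References
* [Rogawski1990] J. D. Rogawski, *Automorphic Representations of Unitary Groups in Three Variables*, Ann. of Math. Stud. 123 (1990): §12.5 pp. 182–185 (Weyl integration formula;
  `α ↦ α^G`; Lemma 12.5.1 and its proof), §4.3 (4.3.1) p. 43, §4.9 p. 55.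
* [HarishChandra1970] Harish-Chandra (notes by G. van Dijk), *Harmonic analysis on reductive p-adic groups*, LNM 162 (1970), Part V §4 Lemma 42.
* [LanglandsShelstad1987] R. P. Langlands, D. Shelstad, *On the definition of transfer factors*, Math. Ann. 278 (1987), §1.3.
-/

set_option autoImplicit false
-- the mandated namespace has the single-problem summit's repeated segment (`HodgeConjecture.HodgeConjecture`)
set_option linter.dupNamespace false

noncomputable section

open MeasureTheory Measure Set Filter Topology Function NumberField IsDedekindDomain Matrix
open Literature.MeasureTheory.Group
open Literature.NumberTheory.Automorphic Literature.NumberTheory.Automorphic.UnitaryGroup Literature.NumberTheory.Rogawski1990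
open Literature.NumberTheory.GaloisRepresentations
open Summit.HodgeConjecture.HodgeConjecture.Cruxes.H413
open Summit.HodgeConjecture.HodgeConjecture.Cruxes.H413.F0P3cStCharTSWeylCartanRadial
open Summit.HodgeConjecture.HodgeConjecture.Cruxes.H413.F0P3cStCharTSWeylHypMeasure
open Summit.HodgeConjecture.HodgeConjecture.Cruxes.H413.F0P3cStCharTSUpTrExchange
open scoped ENNReal NNReal MatrixGroups Pointwise Classical

namespace Summit.HodgeConjecture.HodgeConjecture.Cruxes.H413.F0P3cStCharTSUpTrAssemblyFullCore

section CM

variable (L : Type) [Field L] [NumberField L] [IsCMField L] (v : HeightOneSpectrum (𝓞 ↥(maximalRealSubfield L)))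

/-! ## §1 The currency bridge on one `G`-Cartan: `[N]⁻¹ • ∫_{T′^{reg}} D • (κ · O) = ([N])⁻¹ · ∫_{T′} dG² · κ · O` -/

/-- **CURRENCY BRIDGE.**  On a subgroup `T′ ≤ U(Φ₃)(L⁺_v)` with any measure `tT`: if `dG² = D := √(∏_w|disc χ_t|_w·(∏_w|det t|_w)⁻²)` on the regular set (`hdGsq`, ★ `dgFormula`'s square) and
`κ` vanishes off the regular set, then `([N] : ℝ)⁻¹ • ∫_{t ∈ T′^{reg}} D(t) • (κ t · O t) dtT = ([N] : ℂ)⁻¹ · ∫_{T′} dG(t)² · κ t · O t dtT`. [cite: Rogawski1990, §12.5 p. 182; §4.9 p. 54] -/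
theorem invIndex_smul_setIntegral_weight_eq (hns : ∀ w : PlacesOver L v, IsCMField.complexConj L • w.1 = w.1)
    [MeasurableSpace (Gqs L v)] [BorelSpace (Gqs L v)]
    (T' : Subgroup (Gqs L v)) (tT : Measure ↥T')
    (dG : Gqs L v → ℝ)
    (hdGsq : ∀ t : Gqs L v, IsRegularElt (t.val : GL (Fin 3) (UnitaryGroup.LocalRing L v)) → ((NNReal.sqrt ((∏ w : PlacesOver L v, IsNonarchimedeanLocalField.normAbs (w.1.adicCompletion L) ((((t).val : GL (Fin 3) (UnitaryGroup.LocalRing L v)).val.charpoly.discr) w)) * ((∏ w : PlacesOver L v, IsNonarchimedeanLocalField.normAbs (w.1.adicCompletion L) ((((t).val : GL (Fin 3) (UnitaryGroup.LocalRing L v)).val.det) w)) ^ 2)⁻¹) : ℝ≥0) : ℝ) = dG t * dG t)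
    (κ O : Gqs L v → ℂ) (hκ0 : ∀ t : Gqs L v, ¬ IsRegularElt (t.val : GL (Fin 3) (UnitaryGroup.LocalRing L v)) → κ t = 0) (N : ℕ) :
    ((N : ℝ))⁻¹ • ∫ t in {t : ↥T' | IsRegularElt (((t : Gqs L v)).val : GL (Fin 3) (UnitaryGroup.LocalRing L v))},
        ((NNReal.sqrt ((∏ w : PlacesOver L v, IsNonarchimedeanLocalField.normAbs (w.1.adicCompletion L) ((((t : Gqs L v).val : GL (Fin 3) (UnitaryGroup.LocalRing L v)).val.charpoly.discr) w)) * ((∏ w : PlacesOver L v, IsNonarchimedeanLocalField.normAbs (w.1.adicCompletion L) ((((t : Gqs L v).val : GL (Fin 3) (UnitaryGroup.LocalRing L v)).val.det) w)) ^ 2)⁻¹) : ℝ≥0) : ℝ) •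
          (κ (t : Gqs L v) * O (t : Gqs L v)) ∂tT =
      ((N : ℂ))⁻¹ * ∫ t : ↥T', ((dG (t : Gqs L v) : ℂ)) ^ 2 * κ (t : Gqs L v) * O (t : Gqs L v) ∂tT := by
  have hRm : MeasurableSet {t : ↥T' | IsRegularElt (((t : Gqs L v)).val : GL (Fin 3) (UnitaryGroup.LocalRing L v))} := by
    obtain ⟨w⟩ := (inferInstance : Nonempty (PlacesOver L v))
    exact ((isOpen_setOf_isRegularElt_cmDatum_local (L := L) (H := qsForm L) (v := v) w (hns w)).preimage continuous_subtype_val).measurableSet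
  -- the full integral on the right is the set integral over the regular part (`κ` vanishes off it)
  have h1 : ∫ t : ↥T', ((dG (t : Gqs L v) : ℂ)) ^ 2 * κ (t : Gqs L v) * O (t : Gqs L v) ∂tT =
      ∫ t in {t : ↥T' | IsRegularElt (((t : Gqs L v)).val : GL (Fin 3) (UnitaryGroup.LocalRing L v))}, ((dG (t : Gqs L v) : ℂ)) ^ 2 * κ (t : Gqs L v) * O (t : Gqs L v) ∂tT :=
    (setIntegral_eq_integral_of_forall_compl_eq_zero (fun t ht => by simp only [hκ0 _ ht, mul_zero, zero_mul])).symm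
  -- on the regular part the weight is `dG²`
  have h2 : ∫ t in {t : ↥T' | IsRegularElt (((t : Gqs L v)).val : GL (Fin 3) (UnitaryGroup.LocalRing L v))},
        ((NNReal.sqrt ((∏ w : PlacesOver L v, IsNonarchimedeanLocalField.normAbs (w.1.adicCompletion L) ((((t : Gqs L v).val : GL (Fin 3) (UnitaryGroup.LocalRing L v)).val.charpoly.discr) w)) * ((∏ w : PlacesOver L v, IsNonarchimedeanLocalField.normAbs (w.1.adicCompletion L) ((((t : Gqs L v).val : GL (Fin 3) (UnitaryGroup.LocalRing L v)).val.det) w)) ^ 2)⁻¹) : ℝ≥0) : ℝ) •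
          (κ (t : Gqs L v) * O (t : Gqs L v)) ∂tT =
      ∫ t in {t : ↥T' | IsRegularElt (((t : Gqs L v)).val : GL (Fin 3) (UnitaryGroup.LocalRing L v))}, ((dG (t : Gqs L v) : ℂ)) ^ 2 * κ (t : Gqs L v) * O (t : Gqs L v) ∂tT :=
    setIntegral_congr_fun hRm (fun t ht => by
      show ((NNReal.sqrt ((∏ w : PlacesOver L v, IsNonarchimedeanLocalField.normAbs (w.1.adicCompletion L) ((((t : Gqs L v).val : GL (Fin 3) (UnitaryGroup.LocalRing L v)).val.charpoly.discr) w)) * ((∏ w : PlacesOver L v, IsNonarchimedeanLocalField.normAbs (w.1.adicCompletion L) ((((t : Gqs L v).val : GL (Fin 3) (UnitaryGroup.LocalRing L v)).val.det) w)) ^ 2)⁻¹) : ℝ≥0) : ℝ) •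
            (κ (t : Gqs L v) * O (t : Gqs L v)) = ((dG (t : Gqs L v) : ℂ)) ^ 2 * κ (t : Gqs L v) * O (t : Gqs L v)
      rw [Complex.real_smul, hdGsq _ ht, Complex.ofReal_mul]; ring)
  rw [h2, h1, Complex.real_smul, Complex.ofReal_inv, Complex.ofReal_natCast]

/-! ## §2 The assembly from named inputs -/

set_option maxHeartbeats 3200000 in
set_option synthInstance.maxHeartbeats 400000 in
-- long statement; instance-term unification on the CM local carriers (class of ★ (A1′)-E)
/-- **(A1″)-U3-core «UP-TR ASSEMBLY WITHOUT LOCAL BOUNDEDNESS, FROM NAMED INPUTS».**  `G = U(Φ₃)(L⁺_v)`, `H_v = U(Φ₂) × U(Φ₁)`, `v` non-split; `νQv` Haar, `mQv` canonical; `dG`, `dH`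
ABSTRACT closed forms (`dG` a class function with `D = dG²` on the regular set).  INPUTS BY SHAPE: the `G`-Cartan representatives `C ∋ M` (★ INSTANTIATE-CARTAN letters `hZC hcovC hncC`,
THE core-one Haar measures `μTf`: `hHaarC hinvC hcoreC`), the `H`-Cartan system `SH = insert MH SHc` (`MH ∉ SHc`) with torus measures `tH` whose `G`-singular parts are null (`hsingH`) and
weights `cW`; the elliptic part `hEll` (= (U1)'s head over `Sell := C.erase M` and `SHc`), the split part `hM` (= (U2)'s head at `M`, `MH`), and (A-5) `hSW` = (H6b′)∕(F7b) SWIFH's conclusion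
with the weights `cW`; the ONE integrability hypothesis is that of the GIVEN total `f · α^G`.  THEN **`∫_G f · α^G dνQv = ∫_H f^H · α dνHv`**, `α^G` = (UP-DEF) inline (★ (A1′)-E's text).
[cite: Rogawski1990, §12.5 pp. 182–185, Lemma 12.5.1] [cite: HarishChandra1970, Lemma 42] [cite: LanglandsShelstad1987, §1.3] -/
theorem upTransfer_of_inputs
    (hns : ∀ w : PlacesOver L v, IsCMField.complexConj L • w.1 = w.1)
    [MeasurableSpace (Gqs L v)] [BorelSpace (Gqs L v)] [LocallyCompactSpace (Gqs L v)] [SecondCountableTopology (Gqs L v)] [T2Space (Gqs L v)]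
    [∀ γ' : Gqs L v, MeasurableSpace (Gqs L v ⧸ Subgroup.centralizer ({γ'} : Set (Gqs L v)))]
    [∀ γ' : Gqs L v, BorelSpace (Gqs L v ⧸ Subgroup.centralizer ({γ'} : Set (Gqs L v)))]
    [MeasurableSpace ((UnitaryGroup.cmDatum L 2 (Matrix.of fun i j : Fin 2 => if i.val + j.val + 1 = 2 then (1 : L) else 0)).Local v × (UnitaryGroup.cmDatum L 1 (Matrix.of fun i j : Fin 1 => if i.val + j.val + 1 = 1 then (1 : L) else 0)).Local v)] [BorelSpace ((UnitaryGroup.cmDatum L 2 (Matrix.of fun i j : Fin 2 => if i.val + j.val + 1 = 2 then (1 : L) else 0)).Local v × (UnitaryGroup.cmDatum L 1 (Matrix.of fun i j : Fin 1 => if i.val + j.val + 1 = 1 then (1 : L) else 0)).Local v)]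
    [∀ a : ((UnitaryGroup.cmDatum L 2 (Matrix.of fun i j : Fin 2 => if i.val + j.val + 1 = 2 then (1 : L) else 0)).Local v × (UnitaryGroup.cmDatum L 1 (Matrix.of fun i j : Fin 1 => if i.val + j.val + 1 = 1 then (1 : L) else 0)).Local v), MeasurableSpace (((UnitaryGroup.cmDatum L 2 (Matrix.of fun i j : Fin 2 => if i.val + j.val + 1 = 2 then (1 : L) else 0)).Local v × (UnitaryGroup.cmDatum L 1 (Matrix.of fun i j : Fin 1 => if i.val + j.val + 1 = 1 then (1 : L) else 0)).Local v) ⧸ Subgroup.centralizer ({a} : Set ((UnitaryGroup.cmDatum L 2 (Matrix.of fun i j : Fin 2 => if i.val + j.val + 1 = 2 then (1 : L) else 0)).Local v × (UnitaryGroup.cmDatum L 1 (Matrix.of fun i j : Fin 1 => if i.val + j.val + 1 = 1 then (1 : L) else 0)).Local v)))]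
    (νHv : Measure ((UnitaryGroup.cmDatum L 2 (Matrix.of fun i j : Fin 2 => if i.val + j.val + 1 = 2 then (1 : L) else 0)).Local v × (UnitaryGroup.cmDatum L 1 (Matrix.of fun i j : Fin 1 => if i.val + j.val + 1 = 1 then (1 : L) else 0)).Local v)) (νQv : Measure (Gqs L v)) [νQv.IsHaarMeasure] [νQv.IsMulRightInvariant]
    (mHv : OrbitalMeasureFamily ((UnitaryGroup.cmDatum L 2 (Matrix.of fun i j : Fin 2 => if i.val + j.val + 1 = 2 then (1 : L) else 0)).Local v × (UnitaryGroup.cmDatum L 1 (Matrix.of fun i j : Fin 1 => if i.val + j.val + 1 = 1 then (1 : L) else 0)).Local v)) {mQv : OrbitalMeasureFamily (Gqs L v)}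
    (hcanQ : mQv.IsCanonical (fun γ' => IsRegularElt (γ'.val : GL (Fin 3) (UnitaryGroup.LocalRing L v))) νQv)
    (μ : HeckeCharacter L)
    -- the closed forms, abstract
    (dG : Gqs L v → ℝ) (hdG : ∀ h g : Gqs L v, dG (h * g * h⁻¹) = dG g)
    (hdGsq : ∀ t : Gqs L v, IsRegularElt (t.val : GL (Fin 3) (UnitaryGroup.LocalRing L v)) → ((NNReal.sqrt ((∏ w : PlacesOver L v, IsNonarchimedeanLocalField.normAbs (w.1.adicCompletion L) ((((t).val : GL (Fin 3) (UnitaryGroup.LocalRing L v)).val.charpoly.discr) w)) * ((∏ w : PlacesOver L v, IsNonarchimedeanLocalField.normAbs (w.1.adicCompletion L) ((((t).val : GL (Fin 3) (UnitaryGroup.LocalRing L v)).val.det) w)) ^ 2)⁻¹) : ℝ≥0) : ℝ) = dG t * dG t)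
    (dH : ((UnitaryGroup.cmDatum L 2 (Matrix.of fun i j : Fin 2 => if i.val + j.val + 1 = 2 then (1 : L) else 0)).Local v × (UnitaryGroup.cmDatum L 1 (Matrix.of fun i j : Fin 1 => if i.val + j.val + 1 = 1 then (1 : L) else 0)).Local v) → ℝ)
    -- the `G`-side Cartan representatives `C ∋ M` (★ INSTANTIATE-CARTAN letters) with THE core-one Haar measures
    (C : Finset (Subgroup (Gqs L v))) (M : Subgroup (Gqs L v)) (hMC : M ∈ C)
    (hZC : ∀ T' ∈ C, ∃ γ₀ : Gqs L v, IsRegularElt (γ₀.val : GL (Fin 3) (UnitaryGroup.LocalRing L v)) ∧ T' = Subgroup.centralizer ({γ₀} : Set (Gqs L v)))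
    (hcovC : ∀ γ : Gqs L v, IsRegularElt (γ.val : GL (Fin 3) (UnitaryGroup.LocalRing L v)) → ∃ T' ∈ C, ∃ x : Gqs L v, ∀ g : Gqs L v, g ∈ Subgroup.centralizer ({γ} : Set (Gqs L v)) ↔ x⁻¹ * g * x ∈ T')
    (hncC : ∀ T' ∈ C, ∀ T'' ∈ C, T' ≠ T'' → ∀ y : Gqs L v, ¬ ∀ h : Gqs L v, h ∈ T'' ↔ y⁻¹ * h * y ∈ T')
    (μTf : (T' : Subgroup (Gqs L v)) → Measure ↥T')
    (hHaarC : ∀ T' ∈ C, (μTf T').IsHaarMeasure) (hinvC : ∀ T' ∈ C, (μTf T').IsInvInvariant) (hcoreC : ∀ T' ∈ C, μTf T' (compactCore ↥T') = 1)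
    -- the `H`-side Cartan system `SH = insert MH SHc`, torus measures, weights
    (SH SHc : Finset (Subgroup ((UnitaryGroup.cmDatum L 2 (Matrix.of fun i j : Fin 2 => if i.val + j.val + 1 = 2 then (1 : L) else 0)).Local v × (UnitaryGroup.cmDatum L 1 (Matrix.of fun i j : Fin 1 => if i.val + j.val + 1 = 1 then (1 : L) else 0)).Local v))) (MH : Subgroup ((UnitaryGroup.cmDatum L 2 (Matrix.of fun i j : Fin 2 => if i.val + j.val + 1 = 2 then (1 : L) else 0)).Local v × (UnitaryGroup.cmDatum L 1 (Matrix.of fun i j : Fin 1 => if i.val + j.val + 1 = 1 then (1 : L) else 0)).Local v)) (hSH : SH = insert MH SHc) (hMH : MH ∉ SHc)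
    (tH : (T : Subgroup ((UnitaryGroup.cmDatum L 2 (Matrix.of fun i j : Fin 2 => if i.val + j.val + 1 = 2 then (1 : L) else 0)).Local v × (UnitaryGroup.cmDatum L 1 (Matrix.of fun i j : Fin 1 => if i.val + j.val + 1 = 1 then (1 : L) else 0)).Local v)) → Measure ↥T) (cW : Subgroup ((UnitaryGroup.cmDatum L 2 (Matrix.of fun i j : Fin 2 => if i.val + j.val + 1 = 2 then (1 : L) else 0)).Local v × (UnitaryGroup.cmDatum L 1 (Matrix.of fun i j : Fin 1 => if i.val + j.val + 1 = 1 then (1 : L) else 0)).Local v) → ℂ)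
    (hsingH : ∀ T ∈ SH, tH T {s : ↥T | ¬ IsLocalGRegular L v (s : ((UnitaryGroup.cmDatum L 2 (Matrix.of fun i j : Fin 2 => if i.val + j.val + 1 = 2 then (1 : L) else 0)).Local v × (UnitaryGroup.cmDatum L 1 (Matrix.of fun i j : Fin 1 => if i.val + j.val + 1 = 1 then (1 : L) else 0)).Local v))} = 0)
    -- the analytic data
    (α : ((UnitaryGroup.cmDatum L 2 (Matrix.of fun i j : Fin 2 => if i.val + j.val + 1 = 2 then (1 : L) else 0)).Local v × (UnitaryGroup.cmDatum L 1 (Matrix.of fun i j : Fin 1 => if i.val + j.val + 1 = 1 then (1 : L) else 0)).Local v) → ℂ) (f : Gqs L v → ℂ) (hf : Measurable f) (fH : ((UnitaryGroup.cmDatum L 2 (Matrix.of fun i j : Fin 2 => if i.val + j.val + 1 = 2 then (1 : L) else 0)).Local v × (UnitaryGroup.cmDatum L 1 (Matrix.of fun i j : Fin 1 => if i.val + j.val + 1 = 1 then (1 : L) else 0)).Local v) → ℂ)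
    -- (U1)'s head over `Sell := C.erase M`, `SHc` (BY SHAPE)
    (hEll : ∑ T' ∈ C.erase M, (((T'.subgroupOf (Subgroup.normalizer (T' : Set (Gqs L v)))).index : ℂ))⁻¹ * ∫ t : ↥T', ((dG (t : Gqs L v) : ℂ)) ^ 2 *
      (if IsRegularElt (((t : Gqs L v)).val : GL (Fin 3) (UnitaryGroup.LocalRing L v)) then ((dG (t : Gqs L v) : ℂ))⁻¹ * ∑ᶠ q : Quot (IsLocalStablyConjH L v), (if IsLocalGRegular L v q.out ∧ IsLocalNormPair L (qsForm L) v q.out (t : Gqs L v) then finTau L v q.out μ * (dH q.out : ℂ) * ((finKappaAt L v (qsForm L) q.out (t : Gqs L v) : ℤ) : ℂ) * α q.out else 0) else 0) *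
      classOrbitalIntegral mQv f (ConjClasses.mk (t : Gqs L v)) ∂(μTf T') =
      ∑ T ∈ SHc, cW T * ∫ s : ↥T, ((dH (s : ((UnitaryGroup.cmDatum L 2 (Matrix.of fun i j : Fin 2 => if i.val + j.val + 1 = 2 then (1 : L) else 0)).Local v × (UnitaryGroup.cmDatum L 1 (Matrix.of fun i j : Fin 1 => if i.val + j.val + 1 = 1 then (1 : L) else 0)).Local v)) : ℂ)) ^ 2 * α (s : ((UnitaryGroup.cmDatum L 2 (Matrix.of fun i j : Fin 2 => if i.val + j.val + 1 = 2 then (1 : L) else 0)).Local v × (UnitaryGroup.cmDatum L 1 (Matrix.of fun i j : Fin 1 => if i.val + j.val + 1 = 1 then (1 : L) else 0)).Local v)) * stableOrbitalIntegralRel (IsLocalStablyConjH L v) mHv fH (s : ((UnitaryGroup.cmDatum L 2 (Matrix.of fun i j : Fin 2 => if i.val + j.val + 1 = 2 then (1 : L) else 0)).Local v × (UnitaryGroup.cmDatum L 1 (Matrix.of fun i j : Fin 1 => if i.val + j.val + 1 = 1 then (1 : L) else 0)).Local v)) ∂(tH T))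
    -- (U2)'s head at the split members (BY SHAPE)
    (hM : (((M.subgroupOf (Subgroup.normalizer (M : Set (Gqs L v)))).index : ℂ))⁻¹ * ∫ t : ↥M, ((dG (t : Gqs L v) : ℂ)) ^ 2 *
      (if IsRegularElt (((t : Gqs L v)).val : GL (Fin 3) (UnitaryGroup.LocalRing L v)) then ((dG (t : Gqs L v) : ℂ))⁻¹ * ∑ᶠ q : Quot (IsLocalStablyConjH L v), (if IsLocalGRegular L v q.out ∧ IsLocalNormPair L (qsForm L) v q.out (t : Gqs L v) then finTau L v q.out μ * (dH q.out : ℂ) * ((finKappaAt L v (qsForm L) q.out (t : Gqs L v) : ℤ) : ℂ) * α q.out else 0) else 0) *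
      classOrbitalIntegral mQv f (ConjClasses.mk (t : Gqs L v)) ∂(μTf M) =
      cW MH * ∫ s : ↥MH, ((dH (s : ((UnitaryGroup.cmDatum L 2 (Matrix.of fun i j : Fin 2 => if i.val + j.val + 1 = 2 then (1 : L) else 0)).Local v × (UnitaryGroup.cmDatum L 1 (Matrix.of fun i j : Fin 1 => if i.val + j.val + 1 = 1 then (1 : L) else 0)).Local v)) : ℂ)) ^ 2 * α (s : ((UnitaryGroup.cmDatum L 2 (Matrix.of fun i j : Fin 2 => if i.val + j.val + 1 = 2 then (1 : L) else 0)).Local v × (UnitaryGroup.cmDatum L 1 (Matrix.of fun i j : Fin 1 => if i.val + j.val + 1 = 1 then (1 : L) else 0)).Local v)) * stableOrbitalIntegralRel (IsLocalStablyConjH L v) mHv fH (s : ((UnitaryGroup.cmDatum L 2 (Matrix.of fun i j : Fin 2 => if i.val + j.val + 1 = 2 then (1 : L) else 0)).Local v × (UnitaryGroup.cmDatum L 1 (Matrix.of fun i j : Fin 1 => if i.val + j.val + 1 = 1 then (1 : L) else 0)).Local v)) ∂(tH MH))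
    -- (A-5): (H6b′)∕(F7b) SWIFH's conclusion with the weights `cW`
    (hSW : ∑ T ∈ SH, cW T * ∫ s in {s : ↥T | IsLocalGRegular L v (s : ((UnitaryGroup.cmDatum L 2 (Matrix.of fun i j : Fin 2 => if i.val + j.val + 1 = 2 then (1 : L) else 0)).Local v × (UnitaryGroup.cmDatum L 1 (Matrix.of fun i j : Fin 1 => if i.val + j.val + 1 = 1 then (1 : L) else 0)).Local v))}, ((dH s.1 : ℂ) ^ 2) * α s.1 * stableOrbitalIntegralRel (IsLocalStablyConjH L v) mHv fH s.1 ∂(tH T) =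
      ∫ h, fH h * α h ∂νHv)
    -- the ONE integrability hypothesis: the GIVEN `G`-side total
    (hIG : Integrable (fun g : Gqs L v => f g *
        (if IsRegularElt (g.val : GL (Fin 3) (UnitaryGroup.LocalRing L v)) then
          ((dG g : ℂ))⁻¹ * ∑ᶠ q : Quot (IsLocalStablyConjH L v),
              (if IsLocalGRegular L v q.out ∧ IsLocalNormPair L (qsForm L) v q.out g then
                finTau L v q.out μ * (dH q.out : ℂ) * ((finKappaAt L v (qsForm L) q.out g : ℤ) : ℂ) * α q.out
              else 0)
        else 0)) νQv) :
    ∫ g, f g *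
        (if IsRegularElt (g.val : GL (Fin 3) (UnitaryGroup.LocalRing L v)) then
          ((dG g : ℂ))⁻¹ * ∑ᶠ q : Quot (IsLocalStablyConjH L v),
              (if IsLocalGRegular L v q.out ∧ IsLocalNormPair L (qsForm L) v q.out g then
                finTau L v q.out μ * (dH q.out : ℂ) * ((finKappaAt L v (qsForm L) q.out g : ℤ) : ℂ) * α q.out
              else 0)
        else 0) ∂νQv = ∫ h, fH h * α h ∂νHv := by
  -- ### the up-function, named
  set up : Gqs L v → ℂ := fun x => (if IsRegularElt ((x).val : GL (Fin 3) (UnitaryGroup.LocalRing L v)) then ((dG x : ℂ))⁻¹ * ∑ᶠ q : Quot (IsLocalStablyConjH L v), (if IsLocalGRegular L v q.out ∧ IsLocalNormPair L (qsForm L) v q.out x then finTau L v q.out μ * (dH q.out : ℂ) * ((finKappaAt L v (qsForm L) q.out x : ℤ) : ℂ) * α q.out else 0) else 0) with hup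
  show ∫ g, f g * up g ∂νQv = _
  -- `up` is a class function on the regular set and vanishes off it
  have hupc : ∀ x t : Gqs L v, IsRegularElt (t.val : GL (Fin 3) (UnitaryGroup.LocalRing L v)) → up (x * t * x⁻¹) = up t := by
    intro c x hx
    have hreg : IsRegularElt ((c * x * c⁻¹).val : GL (Fin 3) (UnitaryGroup.LocalRing L v)) := (isRegularElt_conj_val_iff L v c x).2 hx
    show (if IsRegularElt (((c * x * c⁻¹)).val : GL (Fin 3) (UnitaryGroup.LocalRing L v)) then ((dG (c * x * c⁻¹) : ℂ))⁻¹ * ∑ᶠ q : Quot (IsLocalStablyConjH L v), (if IsLocalGRegular L v q.out ∧ IsLocalNormPair L (qsForm L) v q.out (c * x * c⁻¹) then finTau L v q.out μ * (dH q.out : ℂ) * ((finKappaAt L v (qsForm L) q.out (c * x * c⁻¹) : ℤ) : ℂ) * α q.out else 0) else 0) = (if IsRegularElt ((x).val : GL (Fin 3) (UnitaryGroup.LocalRing L v)) then ((dG x : ℂ))⁻¹ * ∑ᶠ q : Quot (IsLocalStablyConjH L v), (if IsLocalGRegular L v q.out ∧ IsLocalNormPair L (qsForm L) v q.out x then finTau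 L v q.out μ * (dH q.out : ℂ) * ((finKappaAt L v (qsForm L) q.out x : ℤ) : ℂ) * α q.out else 0) else 0)
    rw [if_pos hreg, if_pos hx, hdG]
    congr 1
    refine finsum_congr fun q => ?_
    by_cases hR : IsLocalNormPair L (qsForm L) v q.out x
    · have hR' : IsLocalNormPair L (qsForm L) v q.out (c * x * c⁻¹) :=
        F0P3cStCharTSUpTrClaimP.isLocalNormPair_of_isConj_right L v q.out (isConj_iff.2 ⟨c, rfl⟩) hR
      simp only [hR, hR', and_true, finKappaAt_conj_right L v (qsForm L) q.out x c hR]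
    · have hR' : ¬ IsLocalNormPair L (qsForm L) v q.out (c * x * c⁻¹) := fun h =>
        hR (F0P3cStCharTSUpTrClaimP.isLocalNormPair_of_isConj_right L v q.out (isConj_iff.2 ⟨c, rfl⟩ : IsConj x (c * x * c⁻¹)).symm h)
      simp only [hR, hR', and_false, if_false]
  have hup0 : ∀ t : Gqs L v, ¬ IsRegularElt (t.val : GL (Fin 3) (UnitaryGroup.LocalRing L v)) → up t = 0 := fun t ht => by
    show (if IsRegularElt ((t).val : GL (Fin 3) (UnitaryGroup.LocalRing L v)) then ((dG t : ℂ))⁻¹ * ∑ᶠ q : Quot (IsLocalStablyConjH L v), (if IsLocalGRegular L v q.out ∧ IsLocalNormPair L (qsForm L) v q.out t then finTau L v q.out μ * (dH q.out : ℂ) * ((finKappaAt L v (qsForm L) q.out t : ℤ) : ℂ) * α q.out else 0) else 0) = 0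
    rw [if_neg ht]
  -- ### (1) the Cartan partition of `∫_G` over `C` (★ (E2b)-WIF §1, singular set ★ (J8)-null), in the `↥C`-indexed form
  have hγex : ∀ i : ↥C, ∃ γ₀ : Gqs L v, IsRegularElt (γ₀.val : GL (Fin 3) (UnitaryGroup.LocalRing L v)) ∧ (i : Subgroup (Gqs L v)) = Subgroup.centralizer ({γ₀} : Set (Gqs L v)) :=
    fun i => hZC i.1 i.2
  choose γf hγf hTf using hγex
  have hncf : ∀ i j : ↥C, i ≠ j → ∀ y : Gqs L v, ¬ ∀ h : Gqs L v, h ∈ (j : Subgroup (Gqs L v)) ↔ y⁻¹ * h * y ∈ (i : Subgroup (Gqs L v)) :=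
    fun i j hij => hncC i.1 i.2 j.1 j.2 (fun h => hij (Subtype.ext h))
  have hcovf : ∀ g : Gqs L v, IsRegularElt (g.val : GL (Fin 3) (UnitaryGroup.LocalRing L v)) →
      ∃ i : ↥C, ∃ x : Gqs L v, ∀ h : Gqs L v, h ∈ Subgroup.centralizer ({g} : Set (Gqs L v)) ↔ x⁻¹ * h * x ∈ (i : Subgroup (Gqs L v)) := by
    intro g hg
    obtain ⟨T', hT', x, hx⟩ := hcovC g hg
    exact ⟨⟨T', hT'⟩, x, hx⟩
  have hΦex : ∀ i : ↥C, ∃ Φ : (Gqs L v ⧸ (i : Subgroup (Gqs L v))) × ↥(i : Subgroup (Gqs L v)) → Gqs L v,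
      ∀ (x : Gqs L v) (t : ↥(i : Subgroup (Gqs L v))), Φ (QuotientGroup.mk x, t) = x * t * x⁻¹ :=
    fun i => exists_conjFamily (i : Subgroup (Gqs L v)) (mul_comm_cartan (hγf i) (hTf i))
  choose Φf hΦf using hΦex
  letI : ∀ i : ↥C, MeasurableSpace (Gqs L v ⧸ (i : Subgroup (Gqs L v))) := fun i => borel _
  haveI : ∀ i : ↥C, BorelSpace (Gqs L v ⧸ (i : Subgroup (Gqs L v))) := fun i => ⟨rfl⟩
  have hsing := F0P3cStCharTSSingularNull.measure_setOf_not_isRegularElt_Gqs_eq_zero_of_forall L v hns νQv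
  rw [F0P3cStCharTSWeylCartanWIF.integral_eq_sum_setIntegral_cartanSet (T := fun i : ↥C => (i : Subgroup (Gqs L v))) hγf hTf hncf hcovf hns νQv Φf hΦf hsing _ hIG]
  -- ### (2) per member: ★ (N4-b) and the currency bridge
  have hterm : ∀ i : ↥C, ∫ y in {x | ∃ g t : Gqs L v, t ∈ (i : Subgroup (Gqs L v)) ∧ IsRegularElt (t.val : GL (Fin 3) (UnitaryGroup.LocalRing L v)) ∧ g * t * g⁻¹ = x}, f y * up y ∂νQv =
      ((((i : Subgroup (Gqs L v)).subgroupOf (Subgroup.normalizer ((i : Subgroup (Gqs L v)) : Set (Gqs L v)))).index : ℂ))⁻¹ *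
        ∫ t : ↥(i : Subgroup (Gqs L v)), ((dG (t : Gqs L v) : ℂ)) ^ 2 * up (t : Gqs L v) * classOrbitalIntegral mQv f (ConjClasses.mk (t : Gqs L v)) ∂(μTf i) := by
    intro i
    haveI := hHaarC i.1 i.2
    haveI := hinvC i.1 i.2
    rw [F0P3cStCharTSUpTrTubeAnyCartan.setIntegral_mul_classFun_cartanSet_eq L v hns νQv hcanQ (hγf i) (hTf i) (μTf i) (hcoreC i.1 i.2) f up hf hupc hIG.integrableOn]
    exact invIndex_smul_setIntegral_weight_eq L v hns (i : Subgroup (Gqs L v)) (μTf i) dG hdGsq up (fun y => classOrbitalIntegral mQv f (ConjClasses.mk y)) hup0 _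
  rw [Fintype.sum_congr _ _ hterm]
  -- ### (3) split `C = insert M (C.erase M)`: the split member (U2) and the elliptic members (U1)
  rw [Finset.sum_coe_sort C (fun T' : Subgroup (Gqs L v) => (((T'.subgroupOf (Subgroup.normalizer (T' : Set (Gqs L v)))).index : ℂ))⁻¹ *
        ∫ t : ↥T', ((dG (t : Gqs L v) : ℂ)) ^ 2 * up (t : Gqs L v) * classOrbitalIntegral mQv f (ConjClasses.mk (t : Gqs L v)) ∂(μTf T')),
    ← Finset.insert_erase hMC, Finset.sum_insert (Finset.notMem_erase M C), hM, hEll]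
  -- ### (4) the `G`-singular part of each `H`-Cartan is `tH`-null: full integrals are the set integrals of `hSW`
  have hfull : ∀ T ∈ SH, ∫ s in {s : ↥T | IsLocalGRegular L v (s : ((UnitaryGroup.cmDatum L 2 (Matrix.of fun i j : Fin 2 => if i.val + j.val + 1 = 2 then (1 : L) else 0)).Local v × (UnitaryGroup.cmDatum L 1 (Matrix.of fun i j : Fin 1 => if i.val + j.val + 1 = 1 then (1 : L) else 0)).Local v))}, ((dH s.1 : ℂ) ^ 2) * α s.1 * stableOrbitalIntegralRel (IsLocalStablyConjH L v) mHv fH s.1 ∂(tH T) =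
      ∫ s : ↥T, ((dH (s : ((UnitaryGroup.cmDatum L 2 (Matrix.of fun i j : Fin 2 => if i.val + j.val + 1 = 2 then (1 : L) else 0)).Local v × (UnitaryGroup.cmDatum L 1 (Matrix.of fun i j : Fin 1 => if i.val + j.val + 1 = 1 then (1 : L) else 0)).Local v)) : ℂ)) ^ 2 * α (s : ((UnitaryGroup.cmDatum L 2 (Matrix.of fun i j : Fin 2 => if i.val + j.val + 1 = 2 then (1 : L) else 0)).Local v × (UnitaryGroup.cmDatum L 1 (Matrix.of fun i j : Fin 1 => if i.val + j.val + 1 = 1 then (1 : L) else 0)).Local v)) * stableOrbitalIntegralRel (IsLocalStablyConjH L v) mHv fH (s : ((UnitaryGroup.cmDatum L 2 (Matrix.of fun i j : Fin 2 => if i.val + j.val + 1 = 2 then (1 : L) else 0)).Local v × (UnitaryGroup.cmDatum L 1 (Matrix.of fun i j : Fin 1 => if i.val + j.val + 1 = 1 then (1 : L) else 0)).Local v)) ∂(tH T) := by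
    intro T hT
    have hae : ∀ᵐ s ∂(tH T), s ∈ {s : ↥T | IsLocalGRegular L v (s : ((UnitaryGroup.cmDatum L 2 (Matrix.of fun i j : Fin 2 => if i.val + j.val + 1 = 2 then (1 : L) else 0)).Local v × (UnitaryGroup.cmDatum L 1 (Matrix.of fun i j : Fin 1 => if i.val + j.val + 1 = 1 then (1 : L) else 0)).Local v))} := by
      have h := (measure_eq_zero_iff_ae_notMem (μ := tH T)).1 (hsingH T hT)
      filter_upwards [h] with s hs
      simpa using hs
    rw [Measure.restrict_eq_self_of_ae_mem hae]
  rw [← hSW, hSH, Finset.sum_insert hMH, hfull MH (hSH ▸ Finset.mem_insert_self MH SHc)]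
  congr 1
  exact Finset.sum_congr rfl fun T hT => by rw [hfull T (hSH ▸ Finset.mem_insert_of_mem hT)]

end CM

end Summit.HodgeConjecture.HodgeConjecture.Cruxes.H413.F0P3cStCharTSUpTrAssemblyFullCore

end
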